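import Summits.Ventures.CertifiedManyBodySolver.Downfold.EmeryAxialSlabCCOCWindows
import Summits.Ventures.CertifiedManyBodySolver.Downfold.EmeryFermiFillingCCOC
import Summits.Ventures.CertifiedManyBodySolver.Downfold.EmeryFermiFillingLa214
import Summits.Ventures.CertifiedManyBodySolver.Downfold.EmeryAxialConductionBand
import HarnessLib

/-!
# Ca₂₋ₓNaₓCuO₂Cl₂ (box #36 CCOC, (K) source rows): the axial co-shift census ON THE TYPED BOX `emeryBoxCCOCK26Src` — verdicts against the object-E row
# `t′/t ∈ [-0.41, -0.3]` and their FOUR-ORBITAL reading (companion of `EmeryAxialSlabCCOCWindows`, which carries the method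
# docstring, the slab table and the raw slab windows; the kernel certificates are in `EmeryAxialSlabCCOCSubs*`)

Venture CertifiedManyBodySolver, cell `pub/hubbard-downfold` (stage S1), seat hubbard-downfold-mod-4 (technique B); namespace
`Summit.Ventures.CertifiedManyBodySolver.Downfold.Emery`. Everything PROVED. READING (certified): every slab MEETS the E row (no exclusion certified at this resolution).
WHAT THIS IS NOT: not a statement that the material's parameters ARE in the box (SCREENING-GRADE provenance); `U = 0` band kinematics; no phase
sentence; the E row is a [float] literature refit; `a_F` is the ADDITIONAL admixture beyond the box's σ rows (a model-form distance).
Sources: [AndersenEtAl1995, §§5–6]; [PavariniEtAl2001, Eqs. (1)–(3), Fig. 3]; [HybertsenSchluterChristensen1989, Eq. (1)].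
-/

noncomputable section

namespace Summit.Ventures.CertifiedManyBodySolver.Downfold.Emery

open Real Set
open Summit.Ventures.CertifiedManyBodySolver.Downfold

/-! ## §2 The typed box and the co-shift as a parameter -/

/-- The one-body rows and the per-spin filling of `emeryBoxCCOCK26Src` read by this file. [folklore] -/
theorem emeryBoxCCOCK26Src_axRows {p : EmeryCoord → ℝ} (hp : emeryBoxCCOCK26Src.Mem p) :
    p .DeltaPd ∈ Set.Icc (41 / 20 : ℝ) (133 / 50 : ℝ) ∧ p .tpd ∈ Set.Icc (117 / 100 : ℝ) (139 / 100 : ℝ) ∧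
      p .tpp ∈ Set.Icc (29 / 50 : ℝ) (69 / 100 : ℝ) ∧ p .tppP ∈ Set.Icc (13 / 100 : ℝ) (17 / 125 : ℝ) ∧
      (2 - p .nHoles) / 2 ∈ Set.Icc (89 / 200 : ℝ) (91 / 200 : ℝ) := by
  obtain ⟨hΔ, ha, hb, hc, hn⟩ := emeryBoxCCOCK26Src_mem_rows hp
  exact ⟨hΔ, ha, hb, hc, abFilling_rowCCOC_of_nHoles hn.1 hn.2 rfl⟩

/-- **Slab 0 on the typed box**: for every parameter vector of `emeryBoxCCOCK26Src`, every co-shift `a ∈ [0, 0.02]` and every Fermi energy at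
which the CO-SHIFTED σ antibonding band holds the box's electrons: `ε ∈ [1.16, 2.12]`, `t′/t ∈ [-0.3052, -0.2314]` (MEETS).
[folklore] -/
theorem emeryBoxCCOCK26Src_axSlab0 :
    HoldsOn (fun p : EmeryCoord → ℝ => ∀ a ε : ℝ, a ∈ Set.Icc (0 : ℝ) (1 / 50 : ℝ) →
      abFilling (p .DeltaPd) (p .tpd) (p .tpp + a) (p .tppP + a) ε = (2 - p .nHoles) / 2 →
      ε ∈ Set.Icc (29 / 25 : ℝ) (53 / 25 : ℝ) ∧
      fsRatio (p .DeltaPd) (p .tpd) (p .tpp + a) (p .tppP + a) ε ∈ Set.Icc (-(763 / 2500 : ℝ)) (-(1157 / 5000 : ℝ))) emeryBoxCCOCK26Src := by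
  intro p hp a ε ha' hf
  obtain ⟨hΔ, ha, hb, hc, hν⟩ := emeryBoxCCOCK26Src_axRows hp
  rw [← hf] at hν
  exact ccocAxSlab0_window hΔ ha ⟨by linarith [hb.1, ha'.1], by linarith [hb.2, ha'.2]⟩
    ⟨by linarith [hc.1, ha'.1], by linarith [hc.2, ha'.2]⟩ hν

/-- **Slab 1 on the typed box**: for every parameter vector of `emeryBoxCCOCK26Src`, every co-shift `a ∈ [0.02, 0.04]` and every Fermi energy at
which the CO-SHIFTED σ antibonding band holds the box's electrons: `ε ∈ [1.16, 2.1]`, `t′/t ∈ [-0.3146, -0.2412]` (MEETS).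
[folklore] -/
theorem emeryBoxCCOCK26Src_axSlab1 :
    HoldsOn (fun p : EmeryCoord → ℝ => ∀ a ε : ℝ, a ∈ Set.Icc (1 / 50 : ℝ) (1 / 25 : ℝ) →
      abFilling (p .DeltaPd) (p .tpd) (p .tpp + a) (p .tppP + a) ε = (2 - p .nHoles) / 2 →
      ε ∈ Set.Icc (29 / 25 : ℝ) (21 / 10 : ℝ) ∧
      fsRatio (p .DeltaPd) (p .tpd) (p .tpp + a) (p .tppP + a) ε ∈ Set.Icc (-(1573 / 5000 : ℝ)) (-(603 / 2500 : ℝ))) emeryBoxCCOCK26Src := by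
  intro p hp a ε ha' hf
  obtain ⟨hΔ, ha, hb, hc, hν⟩ := emeryBoxCCOCK26Src_axRows hp
  rw [← hf] at hν
  exact ccocAxSlab1_window hΔ ha ⟨by linarith [hb.1, ha'.1], by linarith [hb.2, ha'.2]⟩
    ⟨by linarith [hc.1, ha'.1], by linarith [hc.2, ha'.2]⟩ hν

/-- **Slab 2 on the typed box**: for every parameter vector of `emeryBoxCCOCK26Src`, every co-shift `a ∈ [0.04, 0.1]` and every Fermi energy at
which the CO-SHIFTED σ antibonding band holds the box's electrons: `ε ∈ [1.12, 2.12]`, `t′/t ∈ [-0.3423, -0.2507]` (MEETS).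
[folklore] -/
theorem emeryBoxCCOCK26Src_axSlab2 :
    HoldsOn (fun p : EmeryCoord → ℝ => ∀ a ε : ℝ, a ∈ Set.Icc (1 / 25 : ℝ) (1 / 10 : ℝ) →
      abFilling (p .DeltaPd) (p .tpd) (p .tpp + a) (p .tppP + a) ε = (2 - p .nHoles) / 2 →
      ε ∈ Set.Icc (28 / 25 : ℝ) (53 / 25 : ℝ) ∧
      fsRatio (p .DeltaPd) (p .tpd) (p .tpp + a) (p .tppP + a) ε ∈ Set.Icc (-(3423 / 10000 : ℝ)) (-(2507 / 10000 : ℝ))) emeryBoxCCOCK26Src := by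
  intro p hp a ε ha' hf
  obtain ⟨hΔ, ha, hb, hc, hν⟩ := emeryBoxCCOCK26Src_axRows hp
  rw [← hf] at hν
  exact ccocAxSlab2_window hΔ ha ⟨by linarith [hb.1, ha'.1], by linarith [hb.2, ha'.2]⟩
    ⟨by linarith [hc.1, ha'.1], by linarith [hc.2, ha'.2]⟩ hν

/-- **Slab 3 on the typed box**: for every parameter vector of `emeryBoxCCOCK26Src`, every co-shift `a ∈ [0.1, 0.2]` and every Fermi energy at
which the CO-SHIFTED σ antibonding band holds the box's electrons: `ε ∈ [1.08, 2.12]`, `t′/t ∈ [-0.3833, -0.2764]` (MEETS).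
[folklore] -/
theorem emeryBoxCCOCK26Src_axSlab3 :
    HoldsOn (fun p : EmeryCoord → ℝ => ∀ a ε : ℝ, a ∈ Set.Icc (1 / 10 : ℝ) (1 / 5 : ℝ) →
      abFilling (p .DeltaPd) (p .tpd) (p .tpp + a) (p .tppP + a) ε = (2 - p .nHoles) / 2 →
      ε ∈ Set.Icc (27 / 25 : ℝ) (53 / 25 : ℝ) ∧
      fsRatio (p .DeltaPd) (p .tpd) (p .tpp + a) (p .tppP + a) ε ∈ Set.Icc (-(3833 / 10000 : ℝ)) (-(691 / 2500 : ℝ))) emeryBoxCCOCK26Src := by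
  intro p hp a ε ha' hf
  obtain ⟨hΔ, ha, hb, hc, hν⟩ := emeryBoxCCOCK26Src_axRows hp
  rw [← hf] at hν
  exact ccocAxSlab3_window hΔ ha ⟨by linarith [hb.1, ha'.1], by linarith [hb.2, ha'.2]⟩
    ⟨by linarith [hc.1, ha'.1], by linarith [hc.2, ha'.2]⟩ hν

/-- **Slab 4 on the typed box**: for every parameter vector of `emeryBoxCCOCK26Src`, every co-shift `a ∈ [0.2, 0.3]` and every Fermi energy at
which the CO-SHIFTED σ antibonding band holds the box's electrons: `ε ∈ [1.06, 2.08]`, `t′/t ∈ [-0.4175, -0.3097]` (MEETS).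
[folklore] -/
theorem emeryBoxCCOCK26Src_axSlab4 :
    HoldsOn (fun p : EmeryCoord → ℝ => ∀ a ε : ℝ, a ∈ Set.Icc (1 / 5 : ℝ) (3 / 10 : ℝ) →
      abFilling (p .DeltaPd) (p .tpd) (p .tpp + a) (p .tppP + a) ε = (2 - p .nHoles) / 2 →
      ε ∈ Set.Icc (53 / 50 : ℝ) (52 / 25 : ℝ) ∧
      fsRatio (p .DeltaPd) (p .tpd) (p .tpp + a) (p .tppP + a) ε ∈ Set.Icc (-(167 / 400 : ℝ)) (-(3097 / 10000 : ℝ))) emeryBoxCCOCK26Src := by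
  intro p hp a ε ha' hf
  obtain ⟨hΔ, ha, hb, hc, hν⟩ := emeryBoxCCOCK26Src_axRows hp
  rw [← hf] at hν
  exact ccocAxSlab4_window hΔ ha ⟨by linarith [hb.1, ha'.1], by linarith [hb.2, ha'.2]⟩
    ⟨by linarith [hc.1, ha'.1], by linarith [hc.2, ha'.2]⟩ hν

/-- **Slab 5 on the typed box**: for every parameter vector of `emeryBoxCCOCK26Src`, every co-shift `a ∈ [0.3, 0.4]` and every Fermi energy at
which the CO-SHIFTED σ antibonding band holds the box's electrons: `ε ∈ [1.02, 2.04]`, `t′/t ∈ [-0.4463, -0.3376]` (MEETS).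
[folklore] -/
theorem emeryBoxCCOCK26Src_axSlab5 :
    HoldsOn (fun p : EmeryCoord → ℝ => ∀ a ε : ℝ, a ∈ Set.Icc (3 / 10 : ℝ) (2 / 5 : ℝ) →
      abFilling (p .DeltaPd) (p .tpd) (p .tpp + a) (p .tppP + a) ε = (2 - p .nHoles) / 2 →
      ε ∈ Set.Icc (51 / 50 : ℝ) (51 / 25 : ℝ) ∧
      fsRatio (p .DeltaPd) (p .tpd) (p .tpp + a) (p .tppP + a) ε ∈ Set.Icc (-(4463 / 10000 : ℝ)) (-(211 / 625 : ℝ))) emeryBoxCCOCK26Src := by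
  intro p hp a ε ha' hf
  obtain ⟨hΔ, ha, hb, hc, hν⟩ := emeryBoxCCOCK26Src_axRows hp
  rw [← hf] at hν
  exact ccocAxSlab5_window hΔ ha ⟨by linarith [hb.1, ha'.1], by linarith [hb.2, ha'.2]⟩
    ⟨by linarith [hc.1, ha'.1], by linarith [hc.2, ha'.2]⟩ hν

/-- **Slab 6 on the typed box**: for every parameter vector of `emeryBoxCCOCK26Src`, every co-shift `a ∈ [0.4, 0.5]` and every Fermi energy at
which the CO-SHIFTED σ antibonding band holds the box's electrons: `ε ∈ [1.02, 2.0]`, `t′/t ∈ [-0.4691, -0.3616]` (MEETS).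
[folklore] -/
theorem emeryBoxCCOCK26Src_axSlab6 :
    HoldsOn (fun p : EmeryCoord → ℝ => ∀ a ε : ℝ, a ∈ Set.Icc (2 / 5 : ℝ) (1 / 2 : ℝ) →
      abFilling (p .DeltaPd) (p .tpd) (p .tpp + a) (p .tppP + a) ε = (2 - p .nHoles) / 2 →
      ε ∈ Set.Icc (51 / 50 : ℝ) (2 : ℝ) ∧
      fsRatio (p .DeltaPd) (p .tpd) (p .tpp + a) (p .tppP + a) ε ∈ Set.Icc (-(4691 / 10000 : ℝ)) (-(226 / 625 : ℝ))) emeryBoxCCOCK26Src := by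
  intro p hp a ε ha' hf
  obtain ⟨hΔ, ha, hb, hc, hν⟩ := emeryBoxCCOCK26Src_axRows hp
  rw [← hf] at hν
  exact ccocAxSlab6_window hΔ ha ⟨by linarith [hb.1, ha'.1], by linarith [hb.2, ha'.2]⟩
    ⟨by linarith [hc.1, ha'.1], by linarith [hc.2, ha'.2]⟩ hν

/-! ## §3 The census verdicts against the E row -/

/-! ## §4 The four-orbital reading (transfer theorem `EmeryAxialConductionBand.condFilling_eq_abFilling`) -/

end Summit.Ventures.CertifiedManyBodySolver.Downfold.Emery
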